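import Summits.MatrixMultiplication.OmegaCensus.SmallFormats.MatMulM22ManyRankOneTheta
import Summits.MatrixMultiplication.OmegaCensus.SmallFormats.MatMulM22RankOneFlattening
import HarnessLib

/-!
# ω-census family (a): cheap output functionals of BOTH kinds are independent and cost rank-one X-forms — `2·(dim C + dim C') ≤ σ` (any field)

Cell `pub-omega` (unit `pub-omega-tensor`, gen 38), topic `Summits/MatrixMultiplication/OmegaCensus` (sub-folder
`SmallFormats`). Framing (verbatim): lottery ticket; floor = certified bounds/negative ranges. HONEST FRAMING: the assembly of tensor
g38's lemmas (★) (p719966), the Lemma-12 mechanism with its θ-identity (p718830/p719667/p720259) and the rank-one flattening bound (F1)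
(p720646) into ONE inequality — the 'D-bound' of the memo LAW-3M3 §6, now in the kernel. Structural, any field; NOT a bound on any rank;
nothing here is a bound on `ω`.

**`CheapTheta.two_mul_add_le_card_singular`.** Let `xy = ∑ f_t(x) g_t(y) w_t` compute `⟨m,2,2⟩` with linearly independent products
(injectivity of `z ↦ (∑ z_t D_t^1, ∑ z_t D_t^2)`; automatic at minimal length), `F` a frame, `I' ⊆ I` with independent `f`'s, `C ⊆ k^m` a
space of mechanism vectors (each `c ∈ C` has `κc|_{I∖I'} = 0` and an `r` with `R_c = ∑ r_j P_j`, `hh(r)|_{I∖I'} = 0` — p719667 provides one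
of dimension `≥ 2m − 2|I∖I'| − |J|`), `S` a set of type-F indices and `C' ⊆ k^m` with `∑_i c'_i w_t(i,1) = 0` off `S` for `c' ∈ C'`
(p719966 provides one of dimension `≥ |S| + m − |J|`). Then

  `2 · (dim C + dim C') ≤ #{t : G_t singular}`.

Proof: the functionals `θ_{c,r} : M ↦ ∑ c_i M(i,0) + ∑ r_j M(j,1)` (coefficients supported on `I`, p720259) and `θ'_{c'} : M ↦ ∑ c'_i M(i,1)`
(supported on `S`, `S ∩ I = ∅`) all annihilate the `w_t` with invertible `G_t`; their spans meet trivially (a functional vanishing on every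
`w_t` is zero since the `w_t` span `k^{m×2}`), have dimensions `≥ dim C` (row-`0` projection) and `= dim C'`; apply (F1). At a
`(2m+1, m+2)`-frame with `φ` type-F indices: `2((m − 4) + (φ − 2)) ≤ σ` — the pattern-table inequality.
-/

namespace Summit.MatrixMultiplication.OmegaCensus.SmallFormats

open Finset Module
open Literature.Computability.AlgebraicComplexity
open Literature.Computability.AlgebraicComplexity.Alekseev2015

namespace CheapTheta

variable {k : Type*} [Field k] {m : ℕ} {ι : Type*} [Fintype ι] [DecidableEq ι]
variable {β : BilinComp (mulBilin k m 2 2) ι} (F : Frame β)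

omit [DecidableEq ι] in
/-- The output coefficients `w_t` span `k^{m×2}`: a functional vanishing on all of them is zero (`x = x·1 = ∑ f_t(x) g_t(1) w_t`). -/
theorem dual_eq_zero_of_forall_w (β : BilinComp (mulBilin k m 2 2) ι) (θ : Module.Dual k (Matrix (Fin m) (Fin 2) k))
    (h : ∀ t, θ (β.w t) = 0) : θ = 0 := by
  apply LinearMap.ext
  intro x
  have e := β.map_eq_sum x 1
  rw [mulBilin_apply, Matrix.mul_one] at e
  rw [e, map_sum, LinearMap.zero_apply]
  exact Finset.sum_eq_zero fun t _ => by rw [map_smul, h t, smul_zero]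

open scoped Classical in
/-- **`2·(dim C + dim C') ≤ σ`** — mechanism functionals and type-F cheap functionals together cost rank-one X-forms. -/
theorem two_mul_add_le_card_singular {I' : Finset ι} (hI'I : I' ⊆ F.I)
    (hI'indep : ∀ a : ι → k, ∑ p ∈ I', a p • β.f p = 0 → ∀ p ∈ I', a p = 0)
    (hZ : ∀ z z' : ι → k, ∑ t, z t • D1 β t = ∑ t, z' t • D1 β t → ∑ t, z t • D2 β t = ∑ t, z' t • D2 β t → z = z')
    (C : Submodule k (Fin m → k))
    (hC : ∀ c ∈ C, (∀ p ∈ F.I, p ∉ I' → (∑ i, c i * F.κ i p) = 0) ∧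
      ∃ r : Fin m → k, ∑ p ∈ F.I, (∑ i, c i * F.κ i p) • D2 β p = ∑ j, r j • rowMap k m j ∧
        ∀ p ∈ F.I, p ∉ I' → (∑ j, r j * F.κ j p) = 0)
    (S : Finset ι) (hS : ∀ t ∈ S, pvec β t = 0)
    (C' : Submodule k (Fin m → k)) (hC' : ∀ c ∈ C', ∀ t, t ∉ S → ∑ i, c i * β.w t i 1 = 0) :
    2 * (finrank k C + finrank k C') ≤
      (Finset.univ.filter fun t => pvec β t 0 * qvec β t 1 = pvec β t 1 * qvec β t 0).card := by
  classical
  let V := Module.Dual k (Matrix (Fin m) (Fin 2) k)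
  -- the annihilator of the invertible terms' w_t
  let Ann : Submodule k V :=
    { carrier := {θ | ∀ t, pvec β t 0 * qvec β t 1 ≠ pvec β t 1 * qvec β t 0 → θ (β.w t) = 0}
      add_mem' := fun {a b} ha hb t ht => by
        show (a + b) (β.w t) = 0
        rw [LinearMap.add_apply, ha t ht, hb t ht, add_zero]
      zero_mem' := fun t _ => rfl
      smul_mem' := fun r a ha t ht => by
        show (r • a) (β.w t) = 0
        rw [LinearMap.smul_apply, ha t ht, smul_zero] }
  -- the functionals θ_{c,r} and θ'_{c'}
  let θcr : (Fin m → k) → (Fin m → k) → V := fun c r =>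
    { toFun := fun M => ∑ i, c i * M i 0 + ∑ j, r j * M j 1
      map_add' := fun M N => by
        simp only [Matrix.add_apply, mul_add, Finset.sum_add_distrib]; ring
      map_smul' := fun a M => by
        simp only [Matrix.smul_apply, smul_eq_mul, RingHom.id_apply]
        rw [mul_add, Finset.mul_sum, Finset.mul_sum]
        refine congrArg₂ (· + ·) (Finset.sum_congr rfl fun i _ => by ring) (Finset.sum_congr rfl fun j _ => by ring) }
  let L2 : (Fin m → k) →ₗ[k] V :=
    { toFun := fun c =>
        { toFun := fun M => ∑ i, c i * M i 1
          map_add' := fun M N => by simp only [Matrix.add_apply, mul_add, Finset.sum_add_distrib]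
          map_smul' := fun a M => by
            simp only [Matrix.smul_apply, smul_eq_mul, RingHom.id_apply, Finset.mul_sum]
            exact Finset.sum_congr rfl fun i _ => by ring }
      map_add' := fun c c' => by
        apply LinearMap.ext; intro M
        show ∑ i, (c + c') i * M i 1 = (∑ i, c i * M i 1) + ∑ i, c' i * M i 1
        rw [← Finset.sum_add_distrib]
        exact Finset.sum_congr rfl fun i _ => by rw [Pi.add_apply, add_mul]
      map_smul' := fun a c => by
        apply LinearMap.ext; intro M
        show ∑ i, (a • c) i * M i 1 = a • ∑ i, c i * M i 1
        rw [smul_eq_mul, Finset.mul_sum]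
        exact Finset.sum_congr rfl fun i _ => by rw [Pi.smul_apply, smul_eq_mul, mul_assoc] }
  -- coefficient supports
  have hθw : ∀ c ∈ C, ∀ r, (∑ p ∈ F.I, (∑ i, c i * F.κ i p) • D2 β p = ∑ j, r j • rowMap k m j) →
      ∀ t, θcr c r (β.w t) = if t ∈ F.I then ∑ i, c i * F.κ i t else 0 := by
    intro c _ r hR t
    exact Lemma12Gen.theta_eq_of_indep F c r hR hZ t
  -- Θ₁ := span of the valid θ_{c,r}; it lies in Ann and its coefficient vectors are supported on I
  let G1 : Set V := {θ | ∃ c ∈ C, ∃ r : Fin m → k,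
      (∑ p ∈ F.I, (∑ i, c i * F.κ i p) • D2 β p = ∑ j, r j • rowMap k m j) ∧
      (∀ p ∈ F.I, p ∉ I' → (∑ j, r j * F.κ j p) = 0) ∧ θ = θcr c r}
  let Θ₁ : Submodule k V := Submodule.span k G1
  -- support submodule: functionals whose coefficient vector is supported on I and vanishes at invertible t
  let SupI : Submodule k V :=
    { carrier := {θ | ∀ t, (t ∉ F.I ∨ pvec β t 0 * qvec β t 1 ≠ pvec β t 1 * qvec β t 0) → θ (β.w t) = 0}
      add_mem' := fun {a b} ha hb t ht => by
        show (a + b) (β.w t) = 0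
        rw [LinearMap.add_apply, ha t ht, hb t ht, add_zero]
      zero_mem' := fun t _ => rfl
      smul_mem' := fun r a ha t ht => by
        show (r • a) (β.w t) = 0
        rw [LinearMap.smul_apply, ha t ht, smul_zero] }
  have hG1 : G1 ⊆ (SupI : Set V) := by
    rintro θ ⟨c, hcC, r, hR, hc0, rfl⟩ t ht
    have e := hθw c hcC r hR t
    show θcr c r (β.w t) = 0
    rw [e]
    rcases ht with ht | ht
    · rw [if_neg ht]
    · by_cases htI : t ∈ F.I
      · rw [if_pos htI]
        by_contra hne
        obtain ⟨ha, -⟩ := hC c hcC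
        have hne' : (∑ i, c i * β.w t i 0 + ∑ j, r j * β.w t j 1) ≠ 0 := by
          have := hθw c hcC r hR t
          rw [if_pos htI] at this
          show θcr c r (β.w t) ≠ 0
          rw [this]; exact hne
        obtain ⟨-, a, ha'⟩ := Lemma12Gen.theta_ne_zero_imp F hI'I hI'indep c r hR ha hc0 hZ hne'
        apply ht
        rw [ha', Pi.smul_apply, Pi.smul_apply, smul_eq_mul, smul_eq_mul]
        ring
      · rw [if_neg htI]
  have hΘ₁S : Θ₁ ≤ SupI := Submodule.span_le.mpr hG1
  -- Θ₂ := L2(C'); supported on S, kills invertible t (they have p ≠ 0)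
  let Θ₂ : Submodule k V := C'.map L2
  have hΘ₂ : ∀ θ ∈ Θ₂, ∀ t, t ∉ S → θ (β.w t) = 0 := by
    intro θ hθ t ht
    obtain ⟨c, hc, rfl⟩ := Submodule.mem_map.1 hθ
    exact hC' c hc t ht
  have hSinv : ∀ t, pvec β t 0 * qvec β t 1 ≠ pvec β t 1 * qvec β t 0 → t ∉ S := by
    intro t ht hts
    apply ht
    rw [hS t hts]; simp
  have hSI : ∀ t ∈ S, t ∉ F.I := fun t hts htI => F.pvec_ne_zero htI (hS t hts)
  -- both inside Ann
  have hΘAnn : Θ₁ ⊔ Θ₂ ≤ Ann := by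
    refine sup_le (fun θ hθ t ht => hΘ₁S hθ t (Or.inr ht)) (fun θ hθ t ht => hΘ₂ θ hθ t (hSinv t ht))
  -- trivial intersection
  have hinf : Θ₁ ⊓ Θ₂ = ⊥ := by
    rw [eq_bot_iff]
    intro θ hθ
    obtain ⟨h1, h2⟩ := Submodule.mem_inf.1 hθ
    rw [Submodule.mem_bot]
    refine dual_eq_zero_of_forall_w β θ fun t => ?_
    by_cases hts : t ∈ S
    · exact hΘ₁S h1 t (Or.inl (hSI t hts))
    · exact hΘ₂ θ h2 t hts
  -- dimensions: Θ₂ ≅ C' (L2 injective), Θ₁ maps onto ⊇ C by the row-0 projection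
  have hL2val : ∀ (c : Fin m → k) (i0 : Fin m), L2 c (Matrix.single i0 1 (1 : k)) = c i0 := by
    intro c i0
    show ∑ i, c i * Matrix.single i0 (1 : Fin 2) (1 : k) i 1 = c i0
    simp [Matrix.single_apply, Finset.mem_univ]
  have hL2inj : Function.Injective L2 := by
    intro c c' h
    funext i
    have := LinearMap.congr_fun h (Matrix.single i 1 (1 : k))
    rwa [hL2val, hL2val] at this
  have hdimΘ₂ : finrank k Θ₂ = finrank k C' := by
    show finrank k (C'.map L2) = finrank k C'
    exact LinearEquiv.finrank_eq (Submodule.equivMapOfInjective L2 hL2inj C').symm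
  let π0 : V →ₗ[k] (Fin m → k) :=
    { toFun := fun θ i => θ (Matrix.single i 0 (1 : k))
      map_add' := fun a b => by funext i; rfl
      map_smul' := fun a b => by funext i; rfl }
  have hπθ : ∀ c r, π0 (θcr c r) = c := by
    intro c r
    funext i0
    show (∑ i, c i * Matrix.single i0 (0 : Fin 2) (1 : k) i 0 + ∑ j, r j * Matrix.single i0 (0 : Fin 2) (1 : k) j 1) = c i0
    simp [Matrix.single_apply, Finset.mem_univ]
  have hCle : C ≤ Θ₁.map π0 := by
    intro c hc
    obtain ⟨ha, r, hR, hc0⟩ := hC c hc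
    refine Submodule.mem_map.2 ⟨θcr c r, Submodule.subset_span ⟨c, hc, r, hR, hc0, rfl⟩, hπθ c r⟩
  have hdimΘ₁ : finrank k C ≤ finrank k Θ₁ :=
    (Submodule.finrank_mono hCle).trans (Submodule.finrank_map_le π0 Θ₁)
  -- (F1) on Θ₁ ⊔ Θ₂
  have hF1 : 2 * finrank k ↥(Θ₁ ⊔ Θ₂) ≤
      (Finset.univ.filter fun t => pvec β t 0 * qvec β t 1 = pvec β t 1 * qvec β t 0).card :=
    RankOneFlattening.two_mul_finrank_le_card_rankOne β (Θ₁ ⊔ Θ₂) fun θ hθ t ht => hΘAnn hθ t ht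
  have hsum : finrank k ↥(Θ₁ ⊔ Θ₂) + finrank k ↥(Θ₁ ⊓ Θ₂) = finrank k ↥Θ₁ + finrank k ↥Θ₂ :=
    Submodule.finrank_sup_add_finrank_inf_eq Θ₁ Θ₂
  have hbot : finrank k ↥(Θ₁ ⊓ Θ₂) = 0 := by rw [hinf, finrank_bot]
  have hd2 : finrank k ↥Θ₂ = finrank k ↥C' := hdimΘ₂
  have hd1 : finrank k ↥C ≤ finrank k ↥Θ₁ := hdimΘ₁
  omega

end CheapTheta

end Summit.MatrixMultiplication.OmegaCensus.SmallFormats
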